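import Literature.Barriers.CriticalPhenomena.PositionSpaceRGNonGibbsianPhases
import Literature.Barriers.CriticalPhenomena.PositionSpaceRGNonGibbsianCore
import Literature.Probability.LatticeModels.IsingDecoration
import Mathlib.Analysis.SpecialFunctions.Trigonometric.DerivHyp
import HarnessLib

/-!
# Barrier `PositionSpaceRGNonGibbsian` (van Enter–Fernández–Sokal 1993, Theorem 4.2):
# discharge of `VEFS1993_step22` — the `±` finite-volume one-point functions of the all-`+`
# image system merge at EVERY internal site

Proof file for the named fact `VEFS1993_step22` of
`Literature/Barriers/CriticalPhenomena/PositionSpaceRGNonGibbsianPhases.lean` (van Enter–Fernández–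
Sokal 1993, §4.3.1 Step 2.2, in its Lebowitz–Martin-Löf finite-volume form): for `d ≥ 3`, `β ≥ 0`
and every internal site `x` (`x ∉ 2ℤ^d`),

  `⟨σ_x⟩^{baseBC 1}_{ℤ^d;Λ^int_{R'};β,0} - ⟨σ_x⟩^{baseBC (-1)}_{ℤ^d;Λ^int_{R'};β,0} → 0`  (`R' → ∞`),

where `baseBC s` freezes all image spins to `+1` and puts the internal boundary spins to `s`.

## The printed proof and the proof given here

The source (pp. 110–111) proves uniqueness of the Gibbs measure of this internal-spin system at
all temperatures from the joint analyticity of the pressure in `(J, h)` (Lee–Yang circle theorem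
and Lebowitz–Penrose), which gives (4.28a) `μ⁻(σ_iσ_j) = μ⁺(σ_iσ_j)` for nearest neighbours and
(4.28b) `μ⁻(σ_k) = μ⁺(σ_k)` at the sites `k` carrying the field, and then propagates to all `σ_A`
by Lebowitz' inequality (4.29). The complex-analytic input is not in the tree. Instead:

* (4.28b) — merging at the FIELD sites (internal sites with two image neighbours, i.e. exactly one
  odd coordinate) — is the tree's `tendsto_plusMag_sub_minusMag_gpiVolume'` (`…Core.lean`; GHS
  concavity and convexity of the free energy, Preston's route, via `IsingFieldUniqueness`), stated
  for the diluted graph `ℤ^d ∖ 2ℤ^d` with the periodic field `2·perInd`; the bridge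
  `isingExpect_fixed_eq_fieldExpect_diluted` (`…Diluted.lean`) identifies that system with the
  zero-field model on `ℤ^d` with frozen `+` image spins (`isingExpect_baseBC_one_eq_plusMag`,
  `isingExpect_baseBC_neg_one_eq_minusMag`; `decField_baseBC`: the frozen field is `2·perInd`).
* Propagation to the remaining internal sites is done by a finite-volume FKG/heat-bath inequality
  instead of (4.28a)–(4.29) (`mul_sub_le_sub_of_adj`): for `k ∈ Λ`, `y ∼ k`, `β ≥ 0` and boundary
  conditions `η₁ ≤ η₂`,

    `ε · (⟨σ_y⟩^{η₂}_Λ - ⟨σ_y⟩^{η₁}_Λ) ≤ ⟨σ_k⟩^{η₂}_Λ - ⟨σ_k⟩^{η₁}_Λ`,  `ε = sinh 2β / (2 cosh²(β·#N(k)))`,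

  because `tanh(β ∑_{z∼k} σ_z) - ε σ_y` is nondecreasing (`monotone_tanh_nbr_sub`) and
  `⟨tanh(β ∑_{z∼k} σ_z)⟩^η_Λ = ⟨σ_k⟩^η_Λ` (the heat-bath identity `isingExpect_spinAt_mul_eq_tanh` of
  `IsingDecoration`, Friedli–Velenik 2017 Lemma 6.7; monotonicity in the boundary condition,
  Friedli–Velenik 2017 Exercise 3.13, `isingExpect_fixed_mono`). This is the coupling-free form of
  "agreement of the `±` one-point functions at `k` forces agreement at the neighbours of `k`"
  (cf. the FKG trick of Friedli–Velenik 2017, Lemma 3.33).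
* Geometry (`tendsto_sub_of_card_odd`): an internal site with `m ≥ 2` odd coordinates is adjacent
  to an internal site with `m - 1` odd coordinates (add `eᵢ` along an odd coordinate `i`); induction
  on `m` down to the field sites `m = 1`.
* `β = 0`: all finite-volume one-point functions vanish (`isingExpect_spinAt_of_beta_zero`).

So `VEFS1993_step22_holds` is proved at all `β ≥ 0` (and for all `d`, the hypothesis `d ≥ 3` of the
transcription being unused), without complex analysis. No definition and no named fact is
introduced (D-0014, D-0026); with `VEFS1993_thm42_of_step22` (`…Phases.lean`) this gives a second,
independent discharge of Theorem 4.2 next to `…Holds.lean`.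

## References

* A. C. D. van Enter, R. Fernández, A. D. Sokal, *Regularity properties and pathologies of
  position-space renormalization-group transformations: scope and limitations of Gibbsian
  theory*, J. Stat. Phys. 72 (1993) 879–1167, arXiv:hep-lat/9210032 — §4.3.1 Step 2.2,
  eqs. (4.28)–(4.31), pp. 110–111 [VanenterFernandezSokal1993].
* S. Friedli, Y. Velenik, *Statistical Mechanics of Lattice Systems* (CUP 2017), Exercise 3.13,
  Lemma 3.33, Theorem 3.34, Lemma 6.7 [FriedliVelenik2017].
-/

noncomputable section

open MeasureTheory Finset Filter Topology

namespace Literature.Barriers.CriticalPhenomena.NonGibbs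

open Literature.Probability.LatticeModels

/-! ### A `tanh` increment bound -/

/-- `tanh b - tanh a = sinh(b - a) / (cosh a · cosh b)`. [folklore] -/
theorem tanh_sub_tanh_eq (a b : ℝ) :
    Real.tanh b - Real.tanh a = Real.sinh (b - a) / (Real.cosh a * Real.cosh b) := by
  have ha : Real.cosh a ≠ 0 := (Real.cosh_pos a).ne'
  have hb : Real.cosh b ≠ 0 := (Real.cosh_pos b).ne'
  rw [Real.tanh_eq_sinh_div_cosh, Real.tanh_eq_sinh_div_cosh, Real.sinh_sub,
    div_sub_div _ _ hb ha]
  congr 1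
  ring

/-- The increment of `tanh` between two points of `[-M, M]`:
`tanh b - tanh a ≥ sinh(b - a) / cosh² M` for `a ≤ b`, `|a|, |b| ≤ M`. [folklore] -/
theorem sinh_div_cosh_sq_le_tanh_sub_tanh {a b M : ℝ} (hab : a ≤ b) (ha : |a| ≤ M) (hb : |b| ≤ M) :
    Real.sinh (b - a) / Real.cosh M ^ 2 ≤ Real.tanh b - Real.tanh a := by
  rw [tanh_sub_tanh_eq]
  have hnum : 0 ≤ Real.sinh (b - a) := Real.sinh_nonneg_iff.2 (sub_nonneg.2 hab)
  have hden : 0 < Real.cosh a * Real.cosh b := mul_pos (Real.cosh_pos a) (Real.cosh_pos b)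
  have hM : |M| = M := abs_of_nonneg ((abs_nonneg a).trans ha)
  have hca : Real.cosh a ≤ Real.cosh M := Real.cosh_le_cosh.2 (by rwa [hM])
  have hcb : Real.cosh b ≤ Real.cosh M := Real.cosh_le_cosh.2 (by rwa [hM])
  refine div_le_div_of_nonneg_left hnum hden ?_
  rw [sq]
  exact mul_le_mul hca hcb (Real.cosh_pos b).le ((Real.cosh_pos a).le.trans hca)

/-! ### The neighbour inequality on a general graph -/

section Neighbour

variable {V : Type*} [DecidableEq V] (G : SimpleGraph V) [G.LocallyFinite]

omit [DecidableEq V] [G.LocallyFinite] in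
/-- `|∑_{z ∈ N} σ_z| ≤ #N`. [folklore] -/
theorem abs_sum_spinAt_le_card (N : Finset V) (σ : SpinConfig V) :
    |∑ z ∈ N, spinAt z σ| ≤ (N.card : ℝ) := by
  refine (Finset.abs_sum_le_sum_abs _ _).trans ?_
  rw [Finset.sum_congr rfl fun z _ => abs_spinAt z σ, Finset.sum_const, nsmul_eq_mul, mul_one]

omit [DecidableEq V] in
/-- **The heat-bath test function is nondecreasing.** For `β ≥ 0`, a site `k` with neighbourhood
`N = N(k)` and `y ∈ N`, the function `σ ↦ tanh(β ∑_{z∈N} σ_z) - ε σ_y` with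
`ε = sinh 2β / (2 cosh²(β #N))` is nondecreasing: raising `σ_y` from `-1` to `+1` raises the
neighbour sum by at least `2`, hence `tanh(β·)` by at least `sinh 2β / cosh²(β #N) = 2ε`
(`tanh b - tanh a = sinh(b-a)/(cosh a cosh b)` on `[-β#N, β#N]`). [folklore] -/
theorem monotone_tanh_nbr_sub {β : ℝ} (hβ : 0 ≤ β) {k y : V} (hy : y ∈ G.neighborFinset k) :
    Monotone fun σ : SpinConfig V =>
      Real.tanh (β * ∑ z ∈ G.neighborFinset k, spinAt z σ) +
        -(Real.sinh (2 * β) / (2 * Real.cosh (β * (G.neighborFinset k).card) ^ 2)) * spinAt y σ := by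
  intro σ τ hστ
  dsimp only
  set N := G.neighborFinset k with hN
  set ε := Real.sinh (2 * β) / (2 * Real.cosh (β * N.card) ^ 2) with hε
  set S := ∑ z ∈ N, spinAt z σ with hSdef
  set T := ∑ z ∈ N, spinAt z τ with hTdef
  have hS : S ≤ T := Finset.sum_le_sum fun z _ => spinAt_mono z hστ
  have hyle : spinAt y σ ≤ spinAt y τ := spinAt_mono y hστ
  have hσv : spinAt y σ = 1 ∨ spinAt y σ = -1 := by
    rcases Int.units_eq_one_or (σ y) with h | h <;> simp [spinAt, h]
  have hτv : spinAt y τ = 1 ∨ spinAt y τ = -1 := by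
    rcases Int.units_eq_one_or (τ y) with h | h <;> simp [spinAt, h]
  have hmono : Real.tanh (β * S) ≤ Real.tanh (β * T) :=
    tanh_le_tanh (mul_le_mul_of_nonneg_left hS hβ)
  rcases hσv with hσy | hσy <;> rcases hτv with hτy | hτy
  · rw [hσy, hτy]; linarith
  · rw [hσy, hτy] at hyle; norm_num at hyle
  · -- the spin at `y` flips from `-1` to `+1`: the neighbour sum increases by at least `2`
    have hS2 : S + 2 ≤ T := by
      have hy2 : spinAt y τ - spinAt y σ ≤ ∑ z ∈ N, (spinAt z τ - spinAt z σ) :=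
        Finset.single_le_sum (f := fun z => spinAt z τ - spinAt z σ)
          (fun z _ => sub_nonneg.2 (spinAt_mono z hστ)) hy
      rw [Finset.sum_sub_distrib, ← hSdef, ← hTdef, hσy, hτy] at hy2
      linarith
    have hSabs : |S| ≤ N.card := abs_sum_spinAt_le_card N σ
    have hTabs : |T| ≤ N.card := abs_sum_spinAt_le_card N τ
    have h1 : Real.tanh (β * (S + 2)) ≤ Real.tanh (β * T) :=
      tanh_le_tanh (mul_le_mul_of_nonneg_left hS2 hβ)
    have h2 : Real.sinh (2 * β) / Real.cosh (β * N.card) ^ 2 ≤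
        Real.tanh (β * (S + 2)) - Real.tanh (β * S) := by
      have key := sinh_div_cosh_sq_le_tanh_sub_tanh (a := β * S) (b := β * (S + 2)) (M := β * N.card)
        (mul_le_mul_of_nonneg_left (by linarith) hβ) ?_ ?_
      · rwa [show β * (S + 2) - β * S = 2 * β by ring] at key
      · rw [abs_mul, abs_of_nonneg hβ]
        exact mul_le_mul_of_nonneg_left hSabs hβ
      · rw [abs_mul, abs_of_nonneg hβ]
        refine mul_le_mul_of_nonneg_left (abs_le.2 ⟨?_, ?_⟩) hβ
        · have := (abs_le.1 hSabs).1; linarith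
        · have := (abs_le.1 hTabs).2; linarith
    have hε2 : 2 * ε = Real.sinh (2 * β) / Real.cosh (β * N.card) ^ 2 := by
      rw [hε, ← mul_div_assoc, mul_div_mul_left _ _ (two_ne_zero : (2 : ℝ) ≠ 0)]
    rw [hσy, hτy]
    linarith
  · rw [hσy, hτy]; linarith

/-- **The neighbour inequality** (insensitivity to the boundary condition spreads from a site to
its neighbours). For `β ≥ 0`, zero field, `k ∈ Λ`, `y ∼ k` and boundary conditions `η₁ ≤ η₂`:
`ε (⟨σ_y⟩^{η₂}_Λ - ⟨σ_y⟩^{η₁}_Λ) ≤ ⟨σ_k⟩^{η₂}_Λ - ⟨σ_k⟩^{η₁}_Λ` with `ε = sinh 2β / (2 cosh²(β #N(k)))`.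
Proof: the test function `tanh(β∑_{z∼k}σ_z) - ε σ_y` is nondecreasing, so its `η₁`-expectation is
at most its `η₂`-expectation (monotonicity in the boundary condition, Friedli–Velenik 2017,
Exercise 3.13), and `⟨tanh(β∑_{z∼k}σ_z)⟩^η_Λ = ⟨σ_k⟩^η_Λ` (heat-bath identity, Lemma 6.7).
[cite: FriedliVelenik2017, Exercise 3.13 and Lemma 6.7] -/
theorem mul_sub_le_sub_of_adj {β : ℝ} (hβ : 0 ≤ β) {Λ : Finset V} {k y : V} (hk : k ∈ Λ)
    (hy : y ∈ G.neighborFinset k) {η₁ η₂ : SpinConfig V} (hη : η₁ ≤ η₂) :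
    Real.sinh (2 * β) / (2 * Real.cosh (β * (G.neighborFinset k).card) ^ 2) *
        (isingExpect G Λ β 0 (.fixed η₂) (spinAt y) - isingExpect G Λ β 0 (.fixed η₁) (spinAt y)) ≤
      isingExpect G Λ β 0 (.fixed η₂) (spinAt k) - isingExpect G Λ β 0 (.fixed η₁) (spinAt k) := by
  have hmT : Measurable fun σ : SpinConfig V =>
      Real.tanh (β * ∑ z ∈ G.neighborFinset k, spinAt z σ) :=
    measurable_tanh_comp ((Finset.measurable_sum _ fun z _ => measurable_spinAt z).const_mul β)
  have hmy : Measurable fun σ : SpinConfig V =>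
      -(Real.sinh (2 * β) / (2 * Real.cosh (β * (G.neighborFinset k).card) ^ 2)) * spinAt y σ :=
    (measurable_spinAt y).const_mul _
  have hFKG := isingExpect_fixed_mono G hβ Λ 0 hη (monotone_tanh_nbr_sub G hβ hy) (hmT.add hmy)
  rw [isingExpect_add' G Λ 0 _ β hmT hmy, isingExpect_add' G Λ 0 _ β hmT hmy,
    isingExpect_const_mul' G Λ 0 _ β _ (measurable_spinAt y),
    isingExpect_const_mul' G Λ 0 _ β _ (measurable_spinAt y)] at hFKG
  -- the heat-bath identity `⟨tanh(β ∑_{z∼k} σ_z)⟩^η = ⟨σ_k⟩^η`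
  have htanh : ∀ η : SpinConfig V, isingExpect G Λ β 0 (.fixed η)
      (fun σ => Real.tanh (β * ∑ z ∈ G.neighborFinset k, spinAt z σ)) =
      isingExpect G Λ β 0 (.fixed η) (spinAt k) := fun η => by
    have h1 := isingExpect_spinAt_mul_eq_tanh G hk β η (g := fun _ => (1 : ℝ)) measurable_const
      (fun _ _ => rfl)
    simp only [mul_one] at h1
    exact h1.symm
  rw [htanh, htanh] at hFKG
  linarith

end Neighbour

/-! ### The all-`+` image system: bridge to the periodic-field model on the diluted graph -/

variable {d : ℕ}

/-- **The field of the frozen `+` image spins is the periodic field `2·perInd`**: with all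
decimated spins `+1` (`baseBC d s`, any internal value `s`), the induced field at a site is the
number of its decimated neighbours, `2` at the field sites and `0` elsewhere ("taking the value
`2J` on sites adjacent to image spins and zero elsewhere", §4.3.1 Step 2.2).
[cite: VanenterFernandezSokal1993, §4.3.1 Step 2.2] -/
theorem decField_baseBC (s : ℤˣ) : decField d (baseBC d s) = affCpl 0 (perInd d) 2 := by
  funext k
  have hval : ∀ a ∈ decNbrs d k, spinAt a (baseBC d s) = 1 := fun a ha => by
    have hdec := ((mem_decNbrs d).1 ha).2
    simp [spinAt, baseBC, hdec]
  have hdecF : decField d (baseBC d s) k = (decNbrs d k).card := by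
    rw [decField, Finset.sum_congr rfl hval, Finset.sum_const, nsmul_eq_mul, mul_one]
  have hper : affCpl 0 (perInd d) 2 k = 2 * perInd d k := by
    simp only [affCpl, Pi.zero_apply, zero_add]
  rw [hdecF, hper, perInd]
  by_cases hk : IsDecimatedSite d k
  · -- a decimated site has no decimated neighbour
    have hempty : decNbrs d k = ∅ := Finset.eq_empty_of_forall_notMem fun a ha =>
      not_isDecimatedSite_of_adj hk ((mem_decNbrs d).1 ha).1 ((mem_decNbrs d).1 ha).2
    simp [hempty]
  · rcases decNbrs_eq_empty_or_pair hk with h | ⟨i, -, -, h⟩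
    · simp [h]
    · rw [h, Finset.card_pair (sub_single_ne_add_single k i), if_pos (Finset.insert_nonempty _ _)]
      norm_num

/-- **Bridge, `+` side**: for `x ∈ Λ^int_{R'}`,
`⟨σ_x⟩^{baseBC 1}_{ℤ^d;Λ^int_{R'};β,0} = ⟨σ_x⟩⁺_{𝔻;Λ^int_{R'};β,2·perInd}` (`plusMag` of
`IsingFieldUniqueness` on the diluted graph): the frozen decimated spins are the field `2·perInd`
(`isingExpect_fixed_eq_fieldExpect_diluted`, `decField_baseBC`), and on the diluted graph the boundary
condition is read only at internal sites, where `baseBC d 1 = +1`.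
[cite: VanenterFernandezSokal1993, §4.3.1 Step 2.2] -/
theorem isingExpect_baseBC_one_eq_plusMag {R' : ℕ} {x : Site d} (hx : x ∈ gpiVolume' d R') (β : ℝ) :
    isingExpect (zdGraph d) (gpiVolume' d R') β 0 (.fixed (baseBC d 1)) (spinAt x) =
      plusMag (dilutedGraph d) β (perInd d) (gpiVolume' d R') x 2 := by
  rw [isingExpect_fixed_eq_fieldExpect_diluted (fun y hy => not_isDecimatedSite_of_mem_gpiVolume' hy) β
    (baseBC d 1) (measurable_spinAt x), decField_baseBC, plusMag]
  exact fieldExpect_fixed_congr_outerBoundary (dilutedGraph d)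
    (fun y hy => baseBC_of_not_isDecimatedSite 1 (outerBoundary_dilutedGraph_internal hy)) β _
    (measurable_spinAt x) fun σ σ' h => by simp only [spinAt, h x hx]

/-- **Bridge, `-` side**: for `x ∈ Λ^int_{R'}`,
`⟨σ_x⟩^{baseBC (-1)}_{ℤ^d;Λ^int_{R'};β,0} = ⟨σ_x⟩⁻_{𝔻;Λ^int_{R'};β,2·perInd}` (`minusMag`).
[cite: VanenterFernandezSokal1993, §4.3.1 Step 2.2] -/
theorem isingExpect_baseBC_neg_one_eq_minusMag {R' : ℕ} {x : Site d} (hx : x ∈ gpiVolume' d R')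
    (β : ℝ) :
    isingExpect (zdGraph d) (gpiVolume' d R') β 0 (.fixed (baseBC d (-1))) (spinAt x) =
      minusMag (dilutedGraph d) β (perInd d) (gpiVolume' d R') x 2 := by
  rw [isingExpect_fixed_eq_fieldExpect_diluted (fun y hy => not_isDecimatedSite_of_mem_gpiVolume' hy) β
    (baseBC d (-1)) (measurable_spinAt x), decField_baseBC, minusMag]
  exact fieldExpect_fixed_congr_outerBoundary (dilutedGraph d)
    (fun y hy => baseBC_of_not_isDecimatedSite (-1) (outerBoundary_dilutedGraph_internal hy)) β _
    (measurable_spinAt x) fun σ σ' h => by simp only [spinAt, h x hx]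

/-! ### Merging of the `±` one-point functions: field sites, neighbours, all internal sites -/

/-- **(4.28b) at the field sites** (the tree's GHS route, `tendsto_plusMag_sub_minusMag_gpiVolume'`,
through the bridge): for `β > 0` and an internal site `k` with an image neighbour,
`⟨σ_k⟩^{baseBC 1}_{Λ^int_{R'}} - ⟨σ_k⟩^{baseBC (-1)}_{Λ^int_{R'}} → 0`.
[cite: VanenterFernandezSokal1993, §4.3.1 Step 2.2, eq. (4.28b)] -/
theorem tendsto_sub_of_decNbrs_nonempty {β : ℝ} (hβ : 0 < β) {k : Site d}
    (hk : (decNbrs d k).Nonempty) :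
    Tendsto (fun R' : ℕ =>
      isingExpect (zdGraph d) (gpiVolume' d R') β 0 (.fixed (baseBC d 1)) (spinAt k) -
        isingExpect (zdGraph d) (gpiVolume' d R') β 0 (.fixed (baseBC d (-1))) (spinAt k))
      atTop (𝓝 0) := by
  obtain ⟨a, ha⟩ := hk
  have hkint : ¬IsDecimatedSite d k := not_isDecimatedSite_of_mem_decNbrs ha
  refine (tendsto_plusMag_sub_minusMag_gpiVolume' hβ ⟨a, ha⟩).congr' ?_
  filter_upwards [eventually_subset_gpiVolume' {k} (by simpa using hkint)] with R' hR'
  have hkR' : k ∈ gpiVolume' d R' := hR' (Finset.mem_singleton_self k)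
  rw [isingExpect_baseBC_one_eq_plusMag hkR', isingExpect_baseBC_neg_one_eq_minusMag hkR']

/-- **Propagation to the neighbours**: for `β > 0`, an internal site `k` and `y ∼ k`, if the `±`
one-point functions merge at `k` along the volumes `Λ^int_{R'}` then they merge at `y`
(`0 ≤ ⟨σ_y⟩⁺ - ⟨σ_y⟩⁻ ≤ (⟨σ_k⟩⁺ - ⟨σ_k⟩⁻)/ε` once `k ∈ Λ^int_{R'}`, by `mul_sub_le_sub_of_adj`).
[cite: VanenterFernandezSokal1993, §4.3.1 Step 2.2, eqs. (4.30)–(4.31)] -/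
theorem tendsto_sub_of_adj {β : ℝ} (hβ : 0 < β) {k y : Site d} (hk : ¬IsDecimatedSite d k)
    (hky : (zdGraph d).Adj k y)
    (h : Tendsto (fun R' : ℕ =>
      isingExpect (zdGraph d) (gpiVolume' d R') β 0 (.fixed (baseBC d 1)) (spinAt k) -
        isingExpect (zdGraph d) (gpiVolume' d R') β 0 (.fixed (baseBC d (-1))) (spinAt k))
      atTop (𝓝 0)) :
    Tendsto (fun R' : ℕ =>
      isingExpect (zdGraph d) (gpiVolume' d R') β 0 (.fixed (baseBC d 1)) (spinAt y) -
        isingExpect (zdGraph d) (gpiVolume' d R') β 0 (.fixed (baseBC d (-1))) (spinAt y))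
      atTop (𝓝 0) := by
  set ε := Real.sinh (2 * β) / (2 * Real.cosh (β * ((zdGraph d).neighborFinset k).card) ^ 2) with hε
  have hεpos : 0 < ε :=
    div_pos (Real.sinh_pos_iff.2 (by linarith)) (mul_pos two_pos (pow_pos (Real.cosh_pos _) 2))
  have hy : y ∈ (zdGraph d).neighborFinset k := (SimpleGraph.mem_neighborFinset _ _ _).2 hky
  have hlim : Tendsto (fun R' : ℕ =>
      (isingExpect (zdGraph d) (gpiVolume' d R') β 0 (.fixed (baseBC d 1)) (spinAt k) -
        isingExpect (zdGraph d) (gpiVolume' d R') β 0 (.fixed (baseBC d (-1))) (spinAt k)) / ε)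
      atTop (𝓝 0) := by
    simpa using h.div_const ε
  refine squeeze_zero' (Eventually.of_forall fun R' => sub_nonneg.2 ?_) ?_ hlim
  · exact isingExpect_fixed_mono (zdGraph d) hβ.le _ 0 baseBC_neg_one_le_one (spinAt_mono y)
      (measurable_spinAt y)
  · filter_upwards [eventually_subset_gpiVolume' {k} (by simpa using hk)] with R' hR'
    have hkR' : k ∈ gpiVolume' d R' := hR' (Finset.mem_singleton_self k)
    rw [le_div_iff₀ hεpos, mul_comm]
    exact mul_sub_le_sub_of_adj (zdGraph d) hβ.le hkR' hy baseBC_neg_one_le_one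

/-- **Merging at every internal site**, by induction on the number `m` of odd coordinates: a site
with `m = 0` is decimated; a site with an image neighbour is a field site (base case
`tendsto_sub_of_decNbrs_nonempty`); otherwise adding `eᵢ` along an odd coordinate `i` gives an
internal neighbour with `m - 1` odd coordinates, and `tendsto_sub_of_adj` applies ("it is not hard
to see that all sets `A ⊂ (ℤ^d)_int` are of this form, hence `μ₋ = μ₊`", (4.31)).
[cite: VanenterFernandezSokal1993, §4.3.1 Step 2.2, eqs. (4.30)–(4.31)] -/
theorem tendsto_sub_of_card_odd {β : ℝ} (hβ : 0 < β) :
    ∀ (m : ℕ) (x : Site d), (Finset.univ.filter fun i => ¬ (2 : ℤ) ∣ x i).card = m →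
      ¬IsDecimatedSite d x →
      Tendsto (fun R' : ℕ =>
        isingExpect (zdGraph d) (gpiVolume' d R') β 0 (.fixed (baseBC d 1)) (spinAt x) -
          isingExpect (zdGraph d) (gpiVolume' d R') β 0 (.fixed (baseBC d (-1))) (spinAt x))
        atTop (𝓝 0) := by
  intro m
  induction m with
  | zero =>
    intro x hcard hx
    exfalso
    refine hx fun i => ?_
    by_contra hi
    have hmem : i ∈ Finset.univ.filter fun i => ¬ (2 : ℤ) ∣ x i :=
      Finset.mem_filter.2 ⟨Finset.mem_univ _, hi⟩
    rw [Finset.card_eq_zero.1 hcard] at hmem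
    exact Finset.notMem_empty _ hmem
  | succ m ih =>
    intro x hcard hx
    by_cases hfield : (decNbrs d x).Nonempty
    · exact tendsto_sub_of_decNbrs_nonempty hβ hfield
    · -- an odd coordinate `i`; the neighbour `k = x + eᵢ` has one odd coordinate less
      have hne : (Finset.univ.filter fun i => ¬ (2 : ℤ) ∣ x i).Nonempty := by
        rw [← Finset.card_pos, hcard]; exact Nat.succ_pos m
      obtain ⟨i, hi⟩ := hne
      have hodd : ¬ (2 : ℤ) ∣ x i := (Finset.mem_filter.1 hi).2
      set k : Site d := x + Pi.single i 1 with hk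
      have hadj : (zdGraph d).Adj k x := (zdGraph_adj_iff k x).2 ⟨i, Or.inr rfl⟩
      have hkint : ¬IsDecimatedSite d k := fun hdec =>
        hfield ⟨k, (mem_decNbrs d).2 ⟨hadj.symm, hdec⟩⟩
      have hset : (Finset.univ.filter fun j => ¬ (2 : ℤ) ∣ k j) =
          (Finset.univ.filter fun j => ¬ (2 : ℤ) ∣ x j).erase i := by
        ext j
        simp only [Finset.mem_filter, Finset.mem_univ, true_and, Finset.mem_erase]
        by_cases hji : j = i
        · rw [hji]
          simp only [hk, Pi.add_apply, Pi.single_eq_same, ne_eq, not_true_eq_false, false_and,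
            iff_false, not_not]
          omega
        · simp [hk, Pi.add_apply, hji]
      have hcardk : (Finset.univ.filter fun j => ¬ (2 : ℤ) ∣ k j).card = m := by
        rw [hset, Finset.card_erase_of_mem hi, hcard, Nat.add_sub_cancel]
      exact tendsto_sub_of_adj hβ hkint hadj (ih k hcardk hkint)

/-- **Discharge of `VEFS1993_step22`** (van Enter–Fernández–Sokal 1993, §4.3.1 Step 2.2: the
internal-spin system with all image spins `+` has a unique Gibbs measure at every temperature;
here in the transcribed Lebowitz–Martin-Löf form — the `±` finite-volume one-point functions merge
at every internal site along `Λ^int_{R'}`). At `β = 0` both one-point functions vanish; at `β > 0`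
this is `tendsto_sub_of_card_odd` (GHS uniqueness at the field sites, heat-bath/FKG propagation
to all internal sites). The hypothesis `d ≥ 3` of the transcription is not needed.
[cite: VanenterFernandezSokal1993, §4.3.1 Step 2.2, eqs. (4.28)–(4.31)] -/
theorem VEFS1993_step22_holds : VEFS1993_step22 := by
  intro d _ β hβ x hx
  rcases hβ.eq_or_lt with rfl | hβpos
  · refine tendsto_const_nhds.congr' ?_
    filter_upwards [eventually_subset_gpiVolume' {x} (by simpa using hx)] with R' hR'
    have hxR' : x ∈ gpiVolume' d R' := hR' (Finset.mem_singleton_self x)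
    rw [isingExpect_spinAt_of_beta_zero _ 0 _ hxR', isingExpect_spinAt_of_beta_zero _ 0 _ hxR',
      sub_zero]
  · exact tendsto_sub_of_card_odd hβpos _ x rfl hx

/-- **Discharge of `VEFS1993_step2`** (`…Selection.lean`; §4.3.1 Steps 2.1–2.3, phase selection in
finite volume), through the proved reduction `VEFS1993_step2_of_step22` of `…Phases.lean`.
[cite: VanenterFernandezSokal1993, §4.3.1 Steps 2.1–2.3, eqs. (4.26)–(4.27)] -/
theorem VEFS1993_step2_holds : VEFS1993_step2 :=
  VEFS1993_step2_of_step22 VEFS1993_step22_holds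

end Literature.Barriers.CriticalPhenomena.NonGibbs

end
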